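import Summits.Ventures.YMGap.RobustBall.StaticPotentialTwoSided
import Summits.Ventures.YMGap.RobustBall.StringTensionExplicitSU3
import Summits.Ventures.YMGap.RobustBall.HaarSecondMoments
import HarnessLib

/-!
# Robust ball (Y2), area-law side — SHARP explicit string-tension ceilings from the exact character variance, for every `SU(N)`

HONEST FRAMING: venture file of the cell `pub-ymgap` (QuantumFields programme), track ROBUST-BALL, seat rb-p2 (g5).  LATTICE
statements about the infinite-volume limit states (`infiniteVolumeLimitPoints`) of the `SU(N)` torus Wilson states at tree coupling
`β` (`= β_W/N`); `σ(μ) = stringTension μ χ_N` exists at every `β > 0` (`WilsonStringTension.stringTension_le`).  WHAT IS NEW: the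
ceiling `σ(μ) ≤ −log W_μ(1,1) ≤ −log u₀`, `u₀ = β e^{−8(d−1)Nβ} V₀/(2(d−1)N)` (rb-p2 g3) is made numerical for EVERY `N` by the EXACT
character variance of `HaarSecondMoments` (`V₀(SU(2)) = 1`, `V₀(SU(N)) = 1/2` for `N ≥ 3`, so `V₀ ≥ 1/2` always):
* every `N ≥ 2`, dimension `n + 1 ≥ 2`, every `β > 0`, every limit state: `−log W_μ(1,1), σ(μ) ≤ log(4nN/β) + 8nNβ`
  (`suN_neg_log_plaquette_le`, `suN_stringTension_le_log`; abstract form `stringTension_le_log_of_model`);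
* joined with the every-`N` Bakry–Émery floor `suN_stringTension_ge_log` on the 't Hooft window `2nβ/N ≤ 1/4`:
  ★ `|σ(μ) − log(N/β)| ≤ log(8n) + 8nNβ` (`suN_stringTension_sub_log_abs_le`; `d = 4`: `log 24 + 24Nβ` on `0 < β ≤ N/24`) —
  THE STRONG-COUPLING LAW OF THE STRING TENSION FOR EVERY `SU(N)`, two-sided with certified constants;
* `SU(2)` (V₀ = 1), Wilson coupling `β_W = 2β`: `σ(μ) ≤ log(8n/β_W) + 8nβ_W`, and on `0 < β_W ≤ 2/n` the SYMMETRIC law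
  ★★ `|σ(μ) − log(4/β_W)| ≤ log(2n) + 8nβ_W` (`d = 4`: `log 6 + 24β_W ≤ 1.80 + 24β_W` on `(0, 2/3]`; centred at `log(1/β_W)`:
  `log 24 + 24β_W ≤ 3.18 + 24β_W`, replacing g4's `log(98304/49) + 24β_W ≈ 7.61 + 24β_W` of `su2_stringTension_sub_log_abs_le_dim4`);
  `log(4/β_W)` IS the leading term of the strong-coupling series `σ = −log(I₂(β_W)/I₁(β_W)) = log(4/β_W) + O(β_W²)`;
* the static quark potential: `V_μ(R) ≤ (log(8n/β_W) + 8nβ_W)·R` (SU(2)); `d = 4` two-sided with the g4 floor;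
* `SU(3)`, `d = 4` (V₀ = 1/2): `σ(μ) ≤ log(108/β_W) + 24β_W` at every `β_W > 0`, two-sided with the hypothesis-free floor
  `log((3 − 4β_W)/(4β_W))` on `(0, 3/8]`.
WHAT IT IS NOT: the additive constants are door / one-link artefacts (the `O(β_W²)` of the series is not claimed); `σ`-existence is the
Wilson member's (reflection positivity); nothing continuum / spectral / Clay.

References: K. Wilson, Phys. Rev. D 10 (1974) 2445; E. Seiler, LNP 159 (1982) §2; M. Creutz, Phys. Rev. D 21 (1980) 2308 and
*Quarks, gluons and lattices* (1983) §8–§10 (for comparison only).  Everything here is proved. [folklore]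
-/

noncomputable section

open MeasureTheory Filter Topology
open Literature.MathematicalPhysics.QuantumLattice
open Literature.MathematicalPhysics.QuantumFieldTheory hiding ZdEdge Site

namespace Summit.Ventures.YMGap.RobustBall

namespace StringTensionExplicit

/-! ### Every compact `G ≅ SU(N)`: the ceiling with `V₀ ≥ 1/2` -/

section Model

variable {d N : ℕ} [NeZero d] {G : Type*} [Group G] [TopologicalSpace G] [IsTopologicalGroup G]
  [CompactSpace G] [MeasurableSpace G] [BorelSpace G] [SecondCountableTopology G] [T2Space G]
  (ρ : G →* Matrix (Fin N) (Fin N) ℂ)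

/-- **Explicit plaquette floor for every `G ≅ SU(N)`** (`N ≥ 2`, `d ≥ 2`, every `β > 0`, every infinite-volume limit state):
`−log W_μ(1,1) ≤ log(4(d−1)N/β) + 8(d−1)Nβ` (rb-p2 g3's `−log u₀` with `V₀ ≥ 1/2`, `HaarSecondMoments.half_le_charVariance`).
[folklore] -/
theorem neg_log_plaquette_le_of_model (hρ : IsSpecialUnitaryModel ρ) (hN : 2 ≤ N) (hd : 2 ≤ d) {β : ℝ} (hβ : 0 < β)
    {μ : Measure (LGConfig d G)} (hμ : μ ∈ infiniteVolumeLimitPoints ρ β) :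
    -Real.log (rectExpectation μ (fun g => normalisedCharacter N (ρ g)) 0 1 1 1) ≤
      Real.log (4 * ((d : ℝ) - 1) * N / β) + 8 * ((d : ℝ) - 1) * N * β := by
  obtain ⟨-, -, -, hu⟩ := WilsonStringTension.stringTension_le ρ hρ hN hd hβ hμ
  have hV := HaarSecondMoments.half_le_charVariance ρ hρ hN
  have hN0 : (0 : ℝ) < N := by exact_mod_cast (show 0 < N by omega)
  have hd1 : (0 : ℝ) < (d : ℝ) - 1 := by
    have : (2 : ℝ) ≤ d := by exact_mod_cast hd
    linarith
  set E : ℝ := β * Real.exp (-(8 * ((d : ℝ) - 1) * N * β)) with hE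
  have hE0 : 0 < E := by positivity
  have hden : (0 : ℝ) < 2 * ((d : ℝ) - 1) * N := by positivity
  have hlow : E * (1 / 2) / (2 * ((d : ℝ) - 1) * N) ≤
      E * PlaquetteLowerBound.charVariance ρ / (2 * ((d : ℝ) - 1) * N) :=
    div_le_div_of_nonneg_right (mul_le_mul_of_nonneg_left hV hE0.le) hden.le
  have hpos : 0 < E * (1 / 2) / (2 * ((d : ℝ) - 1) * N) := by positivity
  have hlog := neg_le_neg (Real.log_le_log hpos hlow)
  have hval : -Real.log (E * (1 / 2) / (2 * ((d : ℝ) - 1) * N)) =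
      Real.log (4 * ((d : ℝ) - 1) * N / β) + 8 * ((d : ℝ) - 1) * N * β := by
    have e1 : E * (1 / 2) / (2 * ((d : ℝ) - 1) * N) =
        (β / (4 * ((d : ℝ) - 1) * N)) * Real.exp (-(8 * ((d : ℝ) - 1) * N * β)) := by
      rw [hE]; field_simp; ring
    rw [e1, Real.log_mul (by positivity) (Real.exp_pos _).ne', Real.log_exp]
    have e2 : Real.log (β / (4 * ((d : ℝ) - 1) * N)) = -Real.log (4 * ((d : ℝ) - 1) * N / β) := by
      rw [← Real.log_inv, inv_div]
    rw [e2]; ring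
  linarith

/-- **EXPLICIT STRING-TENSION CEILING for every `G ≅ SU(N)`** (`N ≥ 2`, `d ≥ 2`, every `β > 0`, every infinite-volume limit
state): `σ(μ) ≤ log(4(d−1)N/β) + 8(d−1)Nβ`. [folklore] -/
theorem stringTension_le_log_of_model (hρ : IsSpecialUnitaryModel ρ) (hN : 2 ≤ N) (hd : 2 ≤ d) {β : ℝ} (hβ : 0 < β)
    {μ : Measure (LGConfig d G)} (hμ : μ ∈ infiniteVolumeLimitPoints ρ β) :
    stringTension μ (fun g => normalisedCharacter N (ρ g)) ≤
      Real.log (4 * ((d : ℝ) - 1) * N / β) + 8 * ((d : ℝ) - 1) * N * β := by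
  obtain ⟨-, -, hle, -⟩ := WilsonStringTension.stringTension_le ρ hρ hN hd hβ hμ
  exact hle.trans (neg_log_plaquette_le_of_model ρ hρ hN hd hβ hμ)

end Model

/-! ### `SU(N)`, dimension `n + 1`: every-`N` ceiling and the two-sided law on the 't Hooft window -/

variable {n N : ℕ}

/-- ★ **Every `N ≥ 2`, dimension `n + 1 ≥ 2`, every `β > 0`**: for every infinite-volume limit state of the `SU(N)` torus Wilson
states, `−log W_μ(1,1) ≤ log(4nN/β) + 8nNβ` and `σ(μ) ≤ log(4nN/β) + 8nNβ`. [folklore] -/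
theorem suN_stringTension_le_log (hN : 2 ≤ N) (hn : 1 ≤ n) {β : ℝ} (hβ : 0 < β) {μ : Measure (LGConfig (n + 1) (SUN N))}
    (hμ : haveI : NeZero (n + 1) := ⟨by omega⟩; μ ∈ infiniteVolumeLimitPoints (fundamentalRep (Fin N)) β) :
    haveI : NeZero (n + 1) := ⟨by omega⟩
    (-Real.log (rectExpectation μ (fun g => normalisedCharacter N (fundamentalRep (Fin N) g)) 0 1 1 1) ≤
        Real.log (4 * n * N / β) + 8 * n * N * β) ∧
      stringTension μ (fun g => normalisedCharacter N (fundamentalRep (Fin N) g)) ≤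
        Real.log (4 * n * N / β) + 8 * n * N * β := by
  haveI : NeZero (n + 1) := ⟨by omega⟩
  have hρ := TorusAreaLaw.isSpecialUnitaryModel_fundamentalRep N
  have h1 := neg_log_plaquette_le_of_model (d := n + 1) (fundamentalRep (Fin N)) hρ hN (by omega) hβ hμ
  have h2 := stringTension_le_log_of_model (d := n + 1) (fundamentalRep (Fin N)) hρ hN (by omega) hβ hμ
  have hd : ((n + 1 : ℕ) : ℝ) - 1 = n := by push_cast; ring
  rw [hd] at h1 h2
  exact ⟨h1, h2⟩

/-- ★★ **THE STRONG-COUPLING LAW OF THE STRING TENSION FOR EVERY `SU(N)`, TWO-SIDED** (`N ≥ 2`, dimension `n + 1 ≥ 2`, 't Hooft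
window `0 < β`, `2nβ/N ≤ 1/4`): for every infinite-volume limit state,
`log(N/β) − log(8n) ≤ σ(μ) ≤ log(N/β) + log(4n) + 8nNβ` (floor: the Bakry–Émery modulus, `suN_stringTension_ge_log`; ceiling:
`V₀ ≥ 1/2`). [folklore] -/
theorem suN_stringTension_two_sided (hN : 2 ≤ N) (hn : 1 ≤ n) {β : ℝ} (hβ : 0 < β) (hR : β / N * (2 * (n : ℝ)) ≤ 1 / 4)
    {μ : Measure (LGConfig (n + 1) (SUN N))}
    (hμ : haveI : NeZero (n + 1) := ⟨by omega⟩; μ ∈ infiniteVolumeLimitPoints (fundamentalRep (Fin N)) β) :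
    haveI : NeZero (n + 1) := ⟨by omega⟩
    Real.log (N / β) - Real.log (8 * n) ≤ stringTension μ (fun g => normalisedCharacter N (fundamentalRep (Fin N) g)) ∧
      stringTension μ (fun g => normalisedCharacter N (fundamentalRep (Fin N) g)) ≤
        Real.log (N / β) + Real.log (4 * n) + 8 * n * N * β := by
  haveI : NeZero (n + 1) := ⟨by omega⟩
  have hN0 : (0 : ℝ) < N := by exact_mod_cast (show 0 < N by omega)
  have hn0 : (0 : ℝ) < n := by exact_mod_cast (show 0 < n by omega)
  have habs : |β / N| = β / N := abs_of_pos (div_pos hβ hN0)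
  obtain ⟨-, hlow⟩ := suN_stringTension_ge_log (n := n) hN hn hβ (by rw [habs]; exact hR) hμ
  obtain ⟨-, hup⟩ := suN_stringTension_le_log (n := n) hN hn hβ hμ
  rw [habs] at hlow
  set Rs : ℝ := β / N * (2 * (n : ℝ)) with hRs
  have hRs0 : 0 < Rs := by positivity
  refine ⟨le_trans ?_ hlow, ?_⟩
  · -- `log(N/β) − log(8n) = log(1/(4 R_s)) ≤ log((1/2 − R_s)/R_s)`
    have e1 : Real.log (N / β) - Real.log (8 * n) = Real.log (1 / (4 * Rs)) := by
      rw [← Real.log_div (by positivity) (by positivity), hRs]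
      congr 1
      field_simp
      ring
    rw [e1]
    refine Real.log_le_log (by positivity) ?_
    rw [div_le_div_iff₀ (by positivity) hRs0]
    nlinarith
  · have e2 : Real.log (4 * n * N / β) = Real.log (N / β) + Real.log (4 * n) := by
      rw [← Real.log_mul (by positivity) (by positivity)]
      congr 1
      field_simp
    linarith [e2]

/-- ★★ **Every `SU(N)`: `|σ(μ) − log(N/β)| ≤ log(8n) + 8nNβ`** on the 't Hooft window `0 < β`, `2nβ/N ≤ 1/4` (dimension `n + 1`),
for every infinite-volume limit state. [folklore] -/
theorem suN_stringTension_sub_log_abs_le (hN : 2 ≤ N) (hn : 1 ≤ n) {β : ℝ} (hβ : 0 < β) (hR : β / N * (2 * (n : ℝ)) ≤ 1 / 4)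
    {μ : Measure (LGConfig (n + 1) (SUN N))}
    (hμ : haveI : NeZero (n + 1) := ⟨by omega⟩; μ ∈ infiniteVolumeLimitPoints (fundamentalRep (Fin N)) β) :
    haveI : NeZero (n + 1) := ⟨by omega⟩
    |stringTension μ (fun g => normalisedCharacter N (fundamentalRep (Fin N) g)) - Real.log (N / β)| ≤
      Real.log (8 * n) + 8 * n * N * β := by
  haveI : NeZero (n + 1) := ⟨by omega⟩
  obtain ⟨hlow, hup⟩ := suN_stringTension_two_sided (n := n) hN hn hβ hR hμ
  have hn0 : (0 : ℝ) < n := by exact_mod_cast (show 0 < n by omega)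
  have h48 : Real.log (4 * n) ≤ Real.log (8 * n) := Real.log_le_log (by positivity) (by linarith)
  have hpos : 0 ≤ 8 * (n : ℝ) * N * β := by positivity
  rw [abs_le]
  constructor <;> linarith

/-- ★★ **Every `SU(N)`, `d = 4`: `|σ(μ) − log(N/β)| ≤ log 24 + 24Nβ` for every infinite-volume limit state at every tree coupling
`0 < β ≤ N/24`** (`SU(2)`, `β = β_W/2`: `|σ − log(4/β_W)| ≤ log 24 + 24β_W` on `β_W ≤ 1/6` — the `SU(2)`-specific
`su2_stringTension_sub_log4_abs_le_dim4` below is sharper and wider). [folklore] -/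
theorem suN_stringTension_sub_log_abs_le_dim4 (hN : 2 ≤ N) {β : ℝ} (hβ : 0 < β) (hβ1 : β ≤ N / 24)
    {μ : Measure (LGConfig 4 (SUN N))} (hμ : μ ∈ infiniteVolumeLimitPoints (fundamentalRep (Fin N)) β) :
    |stringTension μ (fun g => normalisedCharacter N (fundamentalRep (Fin N) g)) - Real.log (N / β)| ≤
      Real.log 24 + 24 * N * β := by
  have hN0 : (0 : ℝ) < N := by exact_mod_cast (show 0 < N by omega)
  have hR : β / N * (2 * ((3 : ℕ) : ℝ)) ≤ 1 / 4 := by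
    push_cast
    rw [div_mul_eq_mul_div, div_le_iff₀ hN0]
    linarith
  have h := suN_stringTension_sub_log_abs_le (n := 3) hN (by norm_num) hβ hR hμ
  push_cast at h
  have e : (8 : ℝ) * 3 = 24 := by norm_num
  rw [e] at h
  linarith [h]

/-! ### `SU(2)`: the sharp ceiling (`V₀ = 1`) and the symmetric two-sided law around `log(4/β_W)` -/

/-- **Explicit plaquette floor, SU(2), dimension `n + 1 ≥ 2`, SHARP**: `−log W_μ(1,1) ≤ log(8n/β_W) + 8nβ_W` for every `β_W > 0` and
every infinite-volume limit state at tree coupling `β_W/2` (`V₀(SU(2)) = 1`, `HaarSecondMoments.charVariance_su2`). [folklore] -/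
theorem su2_neg_log_plaquette_le_sharp (hn : 1 ≤ n) {βW : ℝ} (hβ : 0 < βW) {μ : Measure (LGConfig (n + 1) (SUN 2))}
    (hμ : haveI : NeZero (n + 1) := ⟨by omega⟩; μ ∈ infiniteVolumeLimitPoints (fundamentalRep (Fin 2)) (βW / 2)) :
    haveI : NeZero (n + 1) := ⟨by omega⟩
    (-Real.log (rectExpectation μ (fun g => normalisedCharacter 2 (fundamentalRep (Fin 2) g)) 0 1 1 1)) ≤
      Real.log (8 * n / βW) + 8 * n * βW := by
  haveI : NeZero (n + 1) := ⟨by omega⟩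
  have hρ := TorusAreaLaw.isSpecialUnitaryModel_fundamentalRep 2
  obtain ⟨-, -, -, hu⟩ := WilsonStringTension.stringTension_le (d := n + 1) (fundamentalRep (Fin 2)) hρ le_rfl
    (by omega) (by positivity : 0 < βW / 2) hμ
  rw [HaarSecondMoments.charVariance_su2] at hu
  have hnr : (0 : ℝ) < n := by exact_mod_cast (show 0 < n by omega)
  have hd : ((n + 1 : ℕ) : ℝ) - 1 = n := by push_cast; ring
  rw [hd] at hu
  have hval : -Real.log (βW / 2 * Real.exp (-(8 * (n : ℝ) * (2 : ℕ) * (βW / 2))) * 1 / (2 * (n : ℝ) * (2 : ℕ))) =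
      Real.log (8 * n / βW) + 8 * n * βW := by
    have e1 : βW / 2 * Real.exp (-(8 * (n : ℝ) * (2 : ℕ) * (βW / 2))) * 1 / (2 * (n : ℝ) * (2 : ℕ)) =
        (βW / (8 * n)) * Real.exp (-(8 * n * βW)) := by
      push_cast; field_simp; ring_nf
    rw [e1, Real.log_mul (by positivity) (Real.exp_pos _).ne', Real.log_exp]
    have e2 : Real.log (βW / (8 * n)) = -Real.log (8 * n / βW) := by rw [← Real.log_inv, inv_div]
    rw [e2]; ring
  linarith

/-- ★ **SU(2) SHARP CEILING**: `σ(μ) ≤ log(8n/β_W) + 8nβ_W` for every `β_W > 0` and every infinite-volume limit state (dimension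
`n + 1 ≥ 2`; `d = 4`: `log(24/β_W) + 24β_W`). [folklore] -/
theorem su2_stringTension_le_log_sharp (hn : 1 ≤ n) {βW : ℝ} (hβ : 0 < βW) {μ : Measure (LGConfig (n + 1) (SUN 2))}
    (hμ : haveI : NeZero (n + 1) := ⟨by omega⟩; μ ∈ infiniteVolumeLimitPoints (fundamentalRep (Fin 2)) (βW / 2)) :
    haveI : NeZero (n + 1) := ⟨by omega⟩
    stringTension μ (fun g => normalisedCharacter 2 (fundamentalRep (Fin 2) g)) ≤ Real.log (8 * n / βW) + 8 * n * βW := by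
  haveI : NeZero (n + 1) := ⟨by omega⟩
  have hρ := TorusAreaLaw.isSpecialUnitaryModel_fundamentalRep 2
  obtain ⟨-, -, hle, -⟩ := WilsonStringTension.stringTension_le (d := n + 1) (fundamentalRep (Fin 2)) hρ le_rfl
    (by omega) (by positivity : 0 < βW / 2) hμ
  exact hle.trans (su2_neg_log_plaquette_le_sharp hn hβ hμ)

/-- ★★ **SU(2): THE STRONG-COUPLING LAW, SYMMETRIC AROUND ITS LEADING TERM `log(4/β_W)`** (dimension `n + 1 ≥ 2`, `0 < β_W ≤ 2/n`):
for every infinite-volume limit state, `log(4/β_W) − log(2n) ≤ σ(μ) ≤ log(4/β_W) + log(2n) + 8nβ_W`. [folklore] -/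
theorem su2_stringTension_two_sided_sharp (hn : 1 ≤ n) {βW : ℝ} (hβ : 0 < βW) (hβ1 : (n : ℝ) * βW ≤ 2)
    {μ : Measure (LGConfig (n + 1) (SUN 2))}
    (hμ : haveI : NeZero (n + 1) := ⟨by omega⟩; μ ∈ infiniteVolumeLimitPoints (fundamentalRep (Fin 2)) (βW / 2)) :
    haveI : NeZero (n + 1) := ⟨by omega⟩
    Real.log (4 / βW) - Real.log (2 * n) ≤ stringTension μ (fun g => normalisedCharacter 2 (fundamentalRep (Fin 2) g)) ∧
      stringTension μ (fun g => normalisedCharacter 2 (fundamentalRep (Fin 2) g)) ≤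
        Real.log (4 / βW) + Real.log (2 * n) + 8 * n * βW := by
  haveI : NeZero (n + 1) := ⟨by omega⟩
  have hnr : (0 : ℝ) < n := by exact_mod_cast (show 0 < n by omega)
  obtain ⟨-, hlow⟩ := su2_stringTension_ge_log hn hβ hβ1 hμ
  have hup := su2_stringTension_le_log_sharp hn hβ hμ
  have e1 : Real.log (2 / ((n : ℝ) * βW)) = Real.log (4 / βW) - Real.log (2 * n) := by
    rw [← Real.log_div (by positivity) (by positivity)]; congr 1; field_simp; ring
  have e2 : Real.log (8 * n / βW) = Real.log (4 / βW) + Real.log (2 * n) := by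
    rw [← Real.log_mul (by positivity) (by positivity)]; congr 1; field_simp; ring
  rw [e1] at hlow
  rw [e2] at hup
  exact ⟨hlow, hup⟩

/-- ★★ **SU(2): `|σ(μ) − log(4/β_W)| ≤ log(2n) + 8nβ_W`** on `0 < β_W ≤ 2/n` (dimension `n + 1 ≥ 2`), every infinite-volume limit
state. [folklore] -/
theorem su2_stringTension_sub_log4_abs_le (hn : 1 ≤ n) {βW : ℝ} (hβ : 0 < βW) (hβ1 : (n : ℝ) * βW ≤ 2)
    {μ : Measure (LGConfig (n + 1) (SUN 2))}
    (hμ : haveI : NeZero (n + 1) := ⟨by omega⟩; μ ∈ infiniteVolumeLimitPoints (fundamentalRep (Fin 2)) (βW / 2)) :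
    haveI : NeZero (n + 1) := ⟨by omega⟩
    |stringTension μ (fun g => normalisedCharacter 2 (fundamentalRep (Fin 2) g)) - Real.log (4 / βW)| ≤
      Real.log (2 * n) + 8 * n * βW := by
  haveI : NeZero (n + 1) := ⟨by omega⟩
  obtain ⟨hlow, hup⟩ := su2_stringTension_two_sided_sharp hn hβ hβ1 hμ
  have hpos : 0 ≤ 8 * (n : ℝ) * βW := by positivity
  rw [abs_le]
  constructor <;> linarith

/-- ★★ **SU(2), `d = 4`: `|σ(μ) − log(4/β_W)| ≤ log 6 + 24β_W` (`≤ 1.80 + 24β_W`) for every infinite-volume limit state at every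
`0 < β_W ≤ 2/3`.**  `log(4/β_W)` is the leading term of the strong-coupling series of the SU(2) string tension. [folklore] -/
theorem su2_stringTension_sub_log4_abs_le_dim4 {βW : ℝ} (hβ : 0 < βW) (hβ1 : βW ≤ 2 / 3)
    {μ : Measure (LGConfig 4 (SUN 2))} (hμ : μ ∈ infiniteVolumeLimitPoints (fundamentalRep (Fin 2)) (βW / 2)) :
    |stringTension μ (fun g => normalisedCharacter 2 (fundamentalRep (Fin 2) g)) - Real.log (4 / βW)| ≤
      Real.log 6 + 24 * βW := by
  have h := su2_stringTension_sub_log4_abs_le (n := 3) (by norm_num) hβ (by push_cast; linarith) hμ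
  push_cast at h
  have e : (2 : ℝ) * 3 = 6 := by norm_num
  have e' : (8 : ℝ) * 3 * βW = 24 * βW := by ring
  rw [e, e'] at h
  exact h

/-- ★★ **SU(2), `d = 4`, centred at `log(1/β_W)`: `|σ(μ) − log(1/β_W)| ≤ log 24 + 24β_W` (`≤ 3.18 + 24β_W`) on `0 < β_W ≤ 2/3`**,
every infinite-volume limit state — the constant `log(98304/49) ≈ 7.61` of g4's `su2_stringTension_sub_log_abs_le_dim4` sharpened
by the exact `V₀ = 1`. [folklore] -/
theorem su2_stringTension_sub_log_abs_le_dim4_sharp {βW : ℝ} (hβ : 0 < βW) (hβ1 : βW ≤ 2 / 3)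
    {μ : Measure (LGConfig 4 (SUN 2))} (hμ : μ ∈ infiniteVolumeLimitPoints (fundamentalRep (Fin 2)) (βW / 2)) :
    |stringTension μ (fun g => normalisedCharacter 2 (fundamentalRep (Fin 2) g)) - Real.log (1 / βW)| ≤
      Real.log 24 + 24 * βW := by
  have h := su2_stringTension_sub_log4_abs_le_dim4 hβ hβ1 hμ
  have e4 : Real.log (4 / βW) = Real.log 4 + Real.log (1 / βW) := by
    rw [← Real.log_mul (by norm_num) (by positivity)]; congr 1; ring
  have e24 : Real.log (24 : ℝ) = Real.log 4 + Real.log 6 := by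
    rw [← Real.log_mul (by norm_num) (by norm_num)]; norm_num
  have h4 : (0 : ℝ) ≤ Real.log 4 := Real.log_nonneg (by norm_num)
  rw [e4, abs_le] at h
  rw [e24, abs_le]
  obtain ⟨h1, h2⟩ := h
  constructor <;> linarith

/-- ★ **SU(2), `d = 4`, the law as a ratio**: `|σ(μ)/log(4/β_W) − 1| ≤ (log 6 + 24β_W)/log(4/β_W)` on `0 < β_W ≤ 2/3`
(`log(4/β_W) ≥ log 6 > 0`; the right-hand side `→ 0` as `β_W → 0`). [folklore] -/
theorem su2_stringTension_div_log4_sub_one_abs_le_dim4 {βW : ℝ} (hβ : 0 < βW) (hβ1 : βW ≤ 2 / 3)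
    {μ : Measure (LGConfig 4 (SUN 2))} (hμ : μ ∈ infiniteVolumeLimitPoints (fundamentalRep (Fin 2)) (βW / 2)) :
    |stringTension μ (fun g => normalisedCharacter 2 (fundamentalRep (Fin 2) g)) / Real.log (4 / βW) - 1| ≤
      (Real.log 6 + 24 * βW) / Real.log (4 / βW) := by
  have hL : 0 < Real.log (4 / βW) := Real.log_pos (by rw [lt_div_iff₀ hβ]; linarith)
  have h := su2_stringTension_sub_log4_abs_le_dim4 hβ hβ1 hμ
  rw [show stringTension μ (fun g => normalisedCharacter 2 (fundamentalRep (Fin 2) g)) / Real.log (4 / βW) - 1 =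
      (stringTension μ (fun g => normalisedCharacter 2 (fundamentalRep (Fin 2) g)) - Real.log (4 / βW)) / Real.log (4 / βW) by
    field_simp]
  rw [abs_div, abs_of_pos hL]
  exact div_le_div_of_nonneg_right h hL.le

/-- ★ **SU(2), `d = 3`: `|σ(μ) − log(4/β_W)| ≤ log 4 + 16β_W` for every infinite-volume limit state at every `0 < β_W ≤ 1`.**
[folklore] -/
theorem su2_stringTension_sub_log4_abs_le_dim3 {βW : ℝ} (hβ : 0 < βW) (hβ1 : βW ≤ 1)
    {μ : Measure (LGConfig 3 (SUN 2))} (hμ : μ ∈ infiniteVolumeLimitPoints (fundamentalRep (Fin 2)) (βW / 2)) :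
    |stringTension μ (fun g => normalisedCharacter 2 (fundamentalRep (Fin 2) g)) - Real.log (4 / βW)| ≤
      Real.log 4 + 16 * βW := by
  have h := su2_stringTension_sub_log4_abs_le (n := 2) (by norm_num) hβ (by push_cast; linarith) hμ
  push_cast at h
  have e : (2 : ℝ) * 2 = 4 := by norm_num
  have e' : (8 : ℝ) * 2 * βW = 16 * βW := by ring
  rw [e, e'] at h
  exact h

/-! ### `SU(2)`: the static quark potential with the sharp slope ceiling -/

/-- **SU(2), dimension `n + 1 ≥ 2`: `V_μ(R) ≤ (log(8n/β_W) + 8nβ_W)·R`** for every `R`, every `β_W > 0`, every infinite-volume limit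
state (Seiler's «no faster than linear» with the sharp constant). [folklore] -/
theorem su2_staticPotential_le_linear_sharp (hn : 1 ≤ n) {βW : ℝ} (hβ : 0 < βW) {μ : Measure (LGConfig (n + 1) (SUN 2))}
    (hμ : haveI : NeZero (n + 1) := ⟨by omega⟩; μ ∈ infiniteVolumeLimitPoints (fundamentalRep (Fin 2)) (βW / 2)) (R : ℕ) :
    haveI : NeZero (n + 1) := ⟨by omega⟩
    staticPotential μ (fun g => normalisedCharacter 2 (fundamentalRep (Fin 2) g)) R ≤ (Real.log (8 * n / βW) + 8 * n * βW) * R := by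
  haveI : NeZero (n + 1) := ⟨by omega⟩
  have hρ := TorusAreaLaw.isSpecialUnitaryModel_fundamentalRep 2
  have hW := WilsonStringTension.rectExpectation_ne_zero (d := n + 1) (fundamentalRep (Fin 2)) hρ le_rfl (by omega)
    (by positivity : 0 < βW / 2) hμ
  have hc : Continuous (fundamentalRep (Fin 2) : SUN 2 → Matrix (Fin 2) (Fin 2) ℂ) := continuous_fundamentalRep (Fin 2)
  have h1 := StaticPotential.staticPotential_le_mul (fundamentalRep (Fin 2)) (by omega) hc (by positivity : (0 : ℝ) ≤ βW / 2)
    hμ hW R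
  have h2 := StaticPotential.staticPotential_le_neg_log (fundamentalRep (Fin 2)) (by omega) hc
    (by positivity : (0 : ℝ) ≤ βW / 2) hμ hW 1
  have h3 := su2_neg_log_plaquette_le_sharp hn hβ hμ
  have hR : (0 : ℝ) ≤ R := Nat.cast_nonneg R
  calc staticPotential μ (fun g => normalisedCharacter 2 (fundamentalRep (Fin 2) g)) R
      ≤ R * staticPotential μ (fun g => normalisedCharacter 2 (fundamentalRep (Fin 2) g)) 1 := h1
    _ ≤ R * (Real.log (8 * n / βW) + 8 * n * βW) := mul_le_mul_of_nonneg_left (h2.trans h3) hR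
    _ = _ := by ring

/-- ★★ **SU(2), `d = 4`: `log(2/(3β_W))·R − 2·log(512/(3β_W)) ≤ V_μ(R) ≤ (log(24/β_W) + 24β_W)·R`** for every infinite-volume limit
state at every `0 < β_W ≤ 2/3` and every `R ≥ 1` (slopes `log(4/β_W) ∓ log 6`, up to `24β_W`). [folklore] -/
theorem su2_staticPotential_two_sided_dim4_sharp {βW : ℝ} (hβ : 0 < βW) (hβ1 : βW ≤ 2 / 3) {μ : Measure (LGConfig 4 (SUN 2))}
    (hμ : μ ∈ infiniteVolumeLimitPoints (fundamentalRep (Fin 2)) (βW / 2)) (R : ℕ) (hR : 1 ≤ R) :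
    Real.log (2 / (3 * βW)) * R - 2 * Real.log (512 / (3 * βW)) ≤
        staticPotential μ (fun g => normalisedCharacter 2 (fundamentalRep (Fin 2) g)) R ∧
      staticPotential μ (fun g => normalisedCharacter 2 (fundamentalRep (Fin 2) g)) R ≤
        (Real.log (24 / βW) + 24 * βW) * R := by
  obtain ⟨hlow, -⟩ := su2_staticPotential_two_sided_dim4 hβ hβ1 hμ R hR
  have hup := su2_staticPotential_le_linear_sharp (n := 3) (by norm_num) hβ hμ R
  push_cast at hup
  have e : (8 : ℝ) * 3 / βW = 24 / βW := by norm_num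
  have e' : (8 : ℝ) * 3 * βW = 24 * βW := by ring
  rw [e, e'] at hup
  exact ⟨hlow, hup⟩

/-! ### `SU(3)`, `d = 4`: ceiling at every coupling (`V₀ = 1/2`) and the two-sided law -/

/-- ★ **SU(3), `d = 4`: `σ(μ) ≤ log(108/β_W) + 24β_W`** for every `β_W > 0` and every infinite-volume limit state at tree coupling
`β_W/3` (`V₀(SU(3)) = 1/2` exactly, `HaarSecondMoments.charVariance_suN`). [folklore] -/
theorem su3_stringTension_le_log_dim4 {βW : ℝ} (hβ : 0 < βW) {μ : Measure (LGConfig 4 (SUN 3))}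
    (hμ : μ ∈ infiniteVolumeLimitPoints (fundamentalRep (Fin 3)) (βW / 3)) :
    stringTension μ (fun g => normalisedCharacter 3 (fundamentalRep (Fin 3) g)) ≤ Real.log (108 / βW) + 24 * βW := by
  obtain ⟨-, h⟩ := suN_stringTension_le_log (n := 3) (N := 3) (by norm_num) (by norm_num) (by positivity : 0 < βW / 3) hμ
  push_cast at h
  have e : (4 : ℝ) * 3 * 3 / (βW / 3) = 108 / βW := by field_simp; ring
  have e' : (8 : ℝ) * 3 * 3 * (βW / 3) = 24 * βW := by ring
  rw [e, e'] at h
  exact h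

/-- ★ **SU(3), `d = 4`, HYPOTHESIS-FREE TWO-SIDED LAW**: `log((3 − 4β_W)/(4β_W)) ≤ σ(μ) ≤ log(108/β_W) + 24β_W` for every
infinite-volume limit state at every `0 < β_W ≤ 3/8`. [folklore] -/
theorem su3_stringTension_two_sided_dim4 {βW : ℝ} (hβ : 0 < βW) (hβ1 : βW ≤ 3 / 8) {μ : Measure (LGConfig 4 (SUN 3))}
    (hμ : μ ∈ infiniteVolumeLimitPoints (fundamentalRep (Fin 3)) (βW / 3)) :
    Real.log ((3 - 4 * βW) / (4 * βW)) ≤ stringTension μ (fun g => normalisedCharacter 3 (fundamentalRep (Fin 3) g)) ∧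
      stringTension μ (fun g => normalisedCharacter 3 (fundamentalRep (Fin 3) g)) ≤ Real.log (108 / βW) + 24 * βW :=
  ⟨(su3_stringTension_ge_log_dim4 hβ hβ1 hμ).2, su3_stringTension_le_log_dim4 hβ hμ⟩

end StringTensionExplicit

end Summit.Ventures.YMGap.RobustBall
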